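import Summits.HodgeConjecture.HodgeCM.PerL34.ArchCFockAnalyticSmoke_1

/-! PORT of `HodgeCM/PerL34/ArchCFockAnalyticSmoke.lean` (HodgeCMPerL run 82) — part 2: continuation of `Summits.HodgeConjecture.HodgeCM.PerL34.ArchCFockAnalyticSmoke_1` (split at a top-level declaration boundary by port_pkg.py; scope re-opened below; declarations unchanged). -/

-- port_pkg: scope re-opened for this part (file-level context, then the namespace/section stack open at the cut)
set_option autoImplicit false
noncomputable section
open scoped TensorProduct
namespace HodgeCM
namespace PerL34
namespace ArchC
namespace AnalyticSmoke
open HodgeCM.Prior.Perl34File HodgeCM.Prior.Perl34File.Perl34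
local notation "⟪" x ", " y "⟫" => @inner ℂ _ _ x y
namespace Mixed
open HodgeCM.PerL34.Fock
variable (cb : ℂ) (hcb : cb ≠ 0)
/-- … hence `⊗ ℓ` kills every ladder slot of the Fock layer. -/
theorem ell_comp_X (k : (places cb hcb).ιX) : prodFn cb hcb ellM ∘ₗ (places cb hcb).X k = 0 := by
  obtain ⟨b, u⟩ := k
  apply PiTensorProduct.ext
  ext m
  simp only [LinearMap.compMultilinearMap_apply, LinearMap.comp_apply, LinearMap.zero_apply]
  show prodFn cb hcb ellM (Fock.slot b ((loc cb hcb).X u) (PiTensorProduct.tprod ℂ m)) = 0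
  rw [Fock.slot_tprod, prodFn_tprod]
  apply Finset.prod_eq_zero (Finset.mem_univ b)
  rw [Function.update_self]
  exact ellM_raise cb u (m b)

/-- (Ported verbatim from the HodgeCMPerL package; no docstring in the source.) -/
theorem ell_X (k : (places cb hcb).ιX) (φ : (places cb hcb).F) : prodFn cb hcb ellM ((places cb hcb).X k φ) = 0 :=
  LinearMap.congr_fun (ell_comp_X cb hcb k) φ

/-- … and SEES the vacuum: `(⊗ ℓ)(φ⁰) = 1`. -/
theorem ell_φ₀ : prodFn cb hcb ellM (places cb hcb).φ₀ = 1 := by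
  show prodFn cb hcb ellM (PiTensorProduct.tprod ℂ fun _ : Unit => (⟨1, one_mem_kappaPartM⟩ : ↥kappaPartM)) = 1
  rw [prodFn_tprod]
  exact Fintype.prod_eq_one _ fun _ => ellM_one

/-- (Ported verbatim from the HodgeCMPerL package; no docstring in the source.) -/
theorem φ₀_ne_zero : (places cb hcb).φ₀ ≠ 0 := by
  intro h
  have h1 := ell_φ₀ cb hcb
  rw [h, map_zero] at h1
  exact zero_ne_one h1

/-- The trivial torus acts by the identity on `ℂ[P]` (`1 • AlgHom.id` restricted). -/
theorem loc_ω_apply (t : Unit) (x : ↥kappaPartM) : (loc cb hcb).ω t x = x := by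
  apply Subtype.ext
  show (((1 : ℂ) • ((AlgHom.id ℂ MixedModel).toLinearMap.restrict
      (fun _ hf => hf : ∀ f ∈ kappaPartM, (AlgHom.id ℂ MixedModel).toLinearMap f ∈ kappaPartM)) x :
      ↥kappaPartM) : MixedModel) = x
  rw [one_smul, LinearMap.coe_restrict_apply]
  rfl

/-- (Ported verbatim from the HodgeCMPerL package; no docstring in the source.) -/
theorem ωT_eq_id (t : (places cb hcb).Tg) : (places cb hcb).ωT t = LinearMap.id := by
  have h : (fun b => ((places cb hcb).loc b).ω (t b)) =
      fun b => (LinearMap.id : ((places cb hcb).loc b).M →ₗ[ℂ] ((places cb hcb).loc b).M) :=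
    funext fun b => LinearMap.ext (loc_ω_apply cb hcb (t b))
  show PiTensorProduct.map (fun b => ((places cb hcb).loc b).ω (t b)) = LinearMap.id
  rw [h]
  exact PiTensorProduct.map_id

/-- (Ported verbatim from the HodgeCMPerL package; no docstring in the source.) -/
theorem ell_ωT (t : (places cb hcb).Tg) (φ : (places cb hcb).F) :
    prodFn cb hcb ellM ((places cb hcb).ωT t φ) = prodFn cb hcb ellM φ := by
  rw [ωT_eq_id, LinearMap.id_apply]

/-- (Ported verbatim from the HodgeCMPerL package; no docstring in the source.) -/
theorem χ_eq_one (t : (places cb hcb).Tg) : (places cb hcb).χ t = 1 :=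
  Fintype.prod_eq_one _ fun _ => rfl

/-- **The inhabitant over the mixed place with the genuine raising operator.** -/
def bridge : FockAnalyticBridge core torus pointed :=
  bridgeOf (places cb hcb) (prodFn cb hcb ellM) (by rw [ell_φ₀]; exact one_ne_zero) (ell_X cb hcb)
    (ell_ωT cb hcb) (χ_eq_one cb hcb)

include hcb in
/-- (Ported verbatim from the HodgeCMPerL package; no docstring in the source.) -/
theorem nonempty_bridge : Nonempty (FockAnalyticBridge core torus pointed) := ⟨bridge cb hcb⟩

/-- Read-back: the produced N29 datum's Fock space is `⨂ (_ : Unit), ℂ[P]` and its real directions are the raising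
slot. -/
theorem bridge_toArchCDatum :
    (bridge cb hcb).toArchCDatum.F = (places cb hcb).F ∧ (bridge cb hcb).toArchCDatum.ιX = (places cb hcb).ιX :=
  ⟨rfl, rfl⟩

/-- The functional detecting `P`: the `z₀w₀`-coefficient on `ℂ[P]`. -/
def ellP : ↥kappaPartM →ₗ[ℂ] ℂ := (MvPolynomial.lcoeff ℂ (bal (Finsupp.single 0 1))).comp kappaPartM.subtype

/-- (Ported verbatim from the HodgeCMPerL package; no docstring in the source.) -/
theorem coeff_bal_P : MvPolynomial.coeff (bal (Finsupp.single 0 1)) P = 1 := by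
  have h := coeff_bal_P_pow 1 1
  rwa [pow_one, if_pos rfl] at h

/-- (Ported verbatim from the HodgeCMPerL package; no docstring in the source.) -/
theorem ellP_raise_one (u : Unit) : ellP (raise cb u ⟨1, one_mem_kappaPartM⟩) = cb := by
  show MvPolynomial.coeff (bal (Finsupp.single 0 1)) ((raise cb u ⟨1, one_mem_kappaPartM⟩ : ↥kappaPartM) : MixedModel)
    = cb
  rw [raise_apply]
  show MvPolynomial.coeff (bal (Finsupp.single 0 1)) (cb • (P * 1)) = cb
  rw [mul_one, MvPolynomial.coeff_smul, coeff_bal_P, smul_eq_mul, mul_one]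

/-- **Non-vacuity of the analytic clause `hF`: the ladder operator it is checked against is NON-ZERO on φ⁰**
(`X φ⁰ = c_b·P ≠ 0`), although the vacuum functional kills it. -/
theorem X_φ₀_ne_zero : (places cb hcb).X ⟨(), ()⟩ (places cb hcb).φ₀ ≠ 0 := by
  intro h0
  have key := congrArg (prodFn cb hcb ellP) h0
  have hX : (places cb hcb).X ⟨(), ()⟩ (places cb hcb).φ₀ =
      PiTensorProduct.tprod ℂ (Function.update (fun b => ((places cb hcb).loc b).φ) ()
        (raise cb () (((places cb hcb).loc ()).φ))) :=
    Fock.slot_tprod _ _ _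
  rw [hX, prodFn_tprod, map_zero] at key
  obtain ⟨⟨⟩, -, hi⟩ := Finset.prod_eq_zero_iff.mp key
  rw [Function.update_self] at hi
  exact hcb ((ellP_raise_one cb ()).symm.trans hi)

include hcb in
/-- N29 fires through this bridge on the non-vacuous premise `𝒯_1 1 ≠ 0`. -/
theorem H_occ_fires : torus.wOccurs () :=
  (bridge cb hcb).H_occ 1 () ⟨1, Submodule.mem_top, by rw [TΦ_one_one]; exact one_ne_zero⟩

end Mixed

end AnalyticSmoke
end ArchC
end PerL34
end HodgeCM

end
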